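import Mathlib
import Summits.ValiantsHypothesis.ValiantsHypothesis.Theorems.FifoMatchingNNLinearDegreeCofactorHardInflateWordHeights
import HarnessLib

/-!
# Crux `NNLinearDegreeCofactorHard` (stmt-ValiantsHypothesis-23918), line `internal_cofactor`, stub S2b (ii):
# generic word counts — prefix counts ⇒ ballot, height as a letter sum, height parity (unit (A″), part 4a)

Word-agnostic bookkeeping used by `…InflateWordBallot.lean` (and reusable by any queue-word measure):

* `isBallot_of_prefix_le` — if every prefix of a balanced word has `#closers<t ≤ #openers<t`, the word is a ballot word
  (`IsBallot`: the `k`-th opener precedes the `k`-th closer) — the proof of `NNMonotoneHard.isBallot_padWord` made generic;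
* `height_eq_sum_letters` — `#openers<u − #closers<u = Σ_{s<u} ±[W s]`;
* `card_openers_lt_add` — `#openers<u + #closers<u = u` (so the height has the parity of `u`);
* `card_univ_filter_lt` — `#{i : Fin M | i < u} = u`.

Honest framing: elementary counting; nothing here bears on S2b, the crux or VP ≠ VNP.  No definitions, no named facts.
-/

noncomputable section

-- Sub = Summit single-conjunct layout: the duplicated namespace component is mandated by the tree.
set_option linter.dupNamespace false

namespace Summit.ValiantsHypothesis.ValiantsHypothesis.Theorems.FifoMatching.NNLinearDegreeCofactorHard.InflateWord

open Finset Literature.Computability.AlgebraicComplexity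
open Summit.ValiantsHypothesis.ValiantsHypothesis.Theorems.FifoMatching.NNMonotoneHard

/-! ### Generic: words whose prefixes have at least as many openers as closers are ballot words -/

section Generic

variable {M : ℕ} {W : Fin M → Bool}

/-- **Prefix counts ⇒ ballot.**  If at every time `#closers<t ≤ #openers<t`, then the `k`-th opener precedes the
`k`-th closer for every `k` (the proof of `NNMonotoneHard.isBallot_padWord`, made generic). [folklore] -/
theorem isBallot_of_prefix_le (hbal : (closerSet W).card = (openerSet W).card)
    (hpre : ∀ t : ℕ, ((closerSet W).filter fun i => i.val < t).card
      ≤ ((openerSet W).filter fun i => i.val < t).card) :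
    IsBallot W hbal := by
  intro k
  by_contra hge
  rw [not_lt] at hge
  have hne : (closerSet W).orderEmbOfFin hbal k ≠ (openerSet W).orderEmbOfFin rfl k := by
    intro he
    have h1 := apply_closer hbal k
    rw [he, apply_opener k] at h1
    exact Bool.noConfusion h1
  have hlt : (closerSet W).orderEmbOfFin hbal k < (openerSet W).orderEmbOfFin rfl k := lt_of_le_of_ne hge hne
  have h1 : (k : ℕ) < ((closerSet W).filter fun i => i < (openerSet W).orderEmbOfFin rfl k).card :=
    (orderEmbOfFin_lt_iff hbal k _).1 hlt
  have h2 : ((openerSet W).filter fun i => i < (openerSet W).orderEmbOfFin rfl k).card = k :=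
    card_filter_lt_orderEmbOfFin rfl k
  have e1 : ((closerSet W).filter fun i => i < (openerSet W).orderEmbOfFin rfl k)
      = (closerSet W).filter fun i => i.val < ((openerSet W).orderEmbOfFin rfl k).val := by
    ext i; simp only [mem_filter, Fin.lt_def]
  have e2 : ((openerSet W).filter fun i => i < (openerSet W).orderEmbOfFin rfl k)
      = (openerSet W).filter fun i => i.val < ((openerSet W).orderEmbOfFin rfl k).val := by
    ext i; simp only [mem_filter, Fin.lt_def]
  rw [e1] at h1; rw [e2] at h2
  have h3 := hpre ((openerSet W).orderEmbOfFin rfl k).val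
  omega

/-- **Height as a letter sum.**  For every `u ≤ M`, `#openers<u − #closers<u = Σ_{s < u} ±[W s]`. [folklore] -/
theorem height_eq_sum_letters (W : Fin M → Bool) (u : ℕ) (hu : u ≤ M) :
    (((openerSet W).filter fun i => i.val < u).card : ℤ) - (((closerSet W).filter fun i => i.val < u).card : ℤ)
      = ∑ s ∈ (univ : Finset (Fin M)).filter (fun s : Fin M => s.val < u), (if W s = true then (1 : ℤ) else -1) := by
  induction u with
  | zero =>
    rw [card_filter_lt_zero, card_filter_lt_zero]
    rw [Finset.filter_false_of_mem (fun s _ => Nat.not_lt_zero _)]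
    simp
  | succ u ih =>
    have hu' : u < M := hu
    have ih' := ih hu'.le
    rw [card_filter_lt_succ_nat (openerSet W) u, card_filter_lt_succ_nat (closerSet W) u, dif_pos hu', dif_pos hu']
    have hsplit : ((univ : Finset (Fin M)).filter fun s : Fin M => s.val < u + 1)
        = ((univ : Finset (Fin M)).filter fun s : Fin M => s.val < u) ∪ {⟨u, hu'⟩} := by
      ext s
      simp only [mem_filter, mem_univ, true_and, mem_union, mem_singleton, Fin.ext_iff]
      omega
    have hdisj : Disjoint ((univ : Finset (Fin M)).filter fun s : Fin M => s.val < u) {⟨u, hu'⟩} := by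
      rw [disjoint_singleton_right, mem_filter]
      simp
    rw [hsplit, sum_union hdisj, sum_singleton, ← ih']
    by_cases hW : W ⟨u, hu'⟩ = true
    · rw [if_pos (mem_openerSet.2 hW), if_neg (by rw [mem_closerSet, hW]; decide), if_pos hW]
      push_cast; ring
    · rw [if_neg (by rw [mem_openerSet]; exact hW), if_pos (mem_closerSet.2 (Bool.eq_false_iff.2 hW)), if_neg hW]
      push_cast; ring

/-- **Height parity**: `#openers<u + #closers<u = u`, so the height has the parity of `u`. [folklore] -/
theorem card_openers_lt_add (W : Fin M → Bool) (u : ℕ) (hu : u ≤ M) :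
    ((openerSet W).filter fun i => i.val < u).card + ((closerSet W).filter fun i => i.val < u).card = u := by
  induction u with
  | zero => rw [card_filter_lt_zero, card_filter_lt_zero]
  | succ u ih =>
    have hu' : u < M := hu
    rw [card_filter_lt_succ_nat (openerSet W) u, card_filter_lt_succ_nat (closerSet W) u, dif_pos hu', dif_pos hu']
    have := ih hu'.le
    by_cases hW : W ⟨u, hu'⟩ = true
    · rw [if_pos (mem_openerSet.2 hW), if_neg (by rw [mem_closerSet, hW]; decide)]; omega
    · rw [if_neg (by rw [mem_openerSet]; exact hW), if_pos (mem_closerSet.2 (Bool.eq_false_iff.2 hW))]; omega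

/-- `#{i : Fin M | i < u} = u` for `u ≤ M`. [folklore] -/
theorem card_univ_filter_lt {u : ℕ} (hu : u ≤ M) :
    ((univ : Finset (Fin M)).filter fun i : Fin M => i.val < u).card = u := by
  induction u with
  | zero => exact card_filter_lt_zero _
  | succ u ih =>
    have hu' : u < M := hu
    rw [card_filter_lt_succ_nat, dif_pos hu', if_pos (mem_univ _), ih hu'.le]

end Generic

end Summit.ValiantsHypothesis.ValiantsHypothesis.Theorems.FifoMatching.NNLinearDegreeCofactorHard.InflateWord

end
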